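import Literature.Computability.Complexity.ApproximateCounting
import Literature.Computability.Complexity.PostBPPNPOracle
import HarnessLib

/-!
# `PostBPP ⊆ BPP^{NP}` is a theorem (proof file of `ApproximateCounting.lean`)

Sibling proof file of `ApproximateCounting.lean` (D-0014), discharging its named fact
`Literature.Computability.Complexity.PostBPP_subset_BPPRelClass_NP` — Aaronson–Arkhipov, *The
computational complexity of linear optics*, Theory of Computing 9 (2013), §2 eq. (2.1) (p. 162):
"`PostBPP` is easily seen to equal a complexity class called `BPP_path` which was defined by Han,
Hemaspaandra, and Thierauf. In particular, it follows from Han et al.'s results that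
`MA ⊆ PostBPP ⊆ BPP^{NP}`", the bound used inside their Hiding Lemma 5.8 — by the theorem of
Han–Hemaspaandra–Thierauf it quotes (SIAM J. Comput. 26 (1997), Thm. 3.11 (2), `BPP_path ⊆ BPP^{NP}`),
proved in the tree's model along HHT97's own procedure `Approximate`/`Main` (p. 16):

* `SipserCodingLemma.lean`, `BPPPathHashing.lean` — Sipser's Coding Lemma, the hash index `k_X`
  (Cor. 3.10), the runs of `Approximate` and the analysis of `Main`;
* `PostBPPHashCriterion.lean` — the post-selected coin sets `acc(x)`, `rej(x)` of the tree's `PostBPP`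
  and their `t`-fold products (`t = m + 5`), the promise in counting form;
* `PostBPPHashLanguage.lean` — the polynomial-time matrix of Sipser's `Separate` predicate;
* `PostBPPCoinRuns.lean` — the two runs read off one coin string, uniformity of the decoding, the
  comparison with the sharp constant `8(M + 2)`;
* `PostBPPNPOracle.lean` — the `NP` oracle `NoSep`, the truth-table machine `Wit ∈ P^{NoSep}` with
  coins, `mem_BPPRelClass_NP_of_postselection`.

The discharge below unfolds the tree's `PostBPP` (`Cryptography/Postselection.lean`: predicates
`R` (accept), `S` (post-select) in `P`, coin polynomial `p`, thresholds `2/3`, `1/3` conditioned on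
`S`) and applies `mem_BPPRelClass_NP_of_postselection`. Kept out of `ApproximateCounting.lean` so
that the statement file keeps its light import closure (same arrangement as `OracleBPP.lean`,
`IQPPostselectionProofs.lean`).

## References

* S. Aaronson, A. Arkhipov, *The computational complexity of linear optics*, Theory of Computing 9
  (2013) 143–252, §2 eq. (2.1) (p. 162); Lemma 5.8 (p. 192).
* Y. Han, L. A. Hemaspaandra, T. Thierauf, *Threshold computation and cryptographic security*,
  SIAM J. Comput. 26 (1997) 59–78, Thm. 3.11 (2) (p. 15) and its proof (p. 16).
-/

namespace Literature.Computability.Complexity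

/-- **Discharge of `PostBPP_subset_BPPRelClass_NP`** (Aaronson–Arkhipov 2013, eq. (2.1):
`PostBPP ⊆ BPP^{NP}`, after Han–Hemaspaandra–Thierauf 1997, Thm. 3.11 (2): `BPP_path ⊆ BPP^{NP}`):
unfold the tree's `PostBPP` (predicates `R, S ∈ P`, coin polynomial `p`, thresholds `2/3`, `1/3`
conditioned on `S`) and apply `mem_BPPRelClass_NP_of_postselection` (`PostBPPNPOracle.lean`).
[cite: AaronsonArkhipovToC2013, §2 eq. (2.1) (p. 162)] -/
theorem PostBPP_subset_BPPRelClass_NP_holds : PostBPP_subset_BPPRelClass_NP :=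
  fun _ ⟨_, hR, _, hS, p, h⟩ => mem_BPPRelClass_NP_of_postselection hR hS p h

end Literature.Computability.Complexity
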